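/-
Copyright: literature formalisation (no new mathematics).  Bałaban, *Propagators and renormalization transformations for
lattice gauge theories. II*, Commun. Math. Phys. 96 (1984) 223–250 — the decomposition (2.47) of a shortest admissible
contour of (2.46) and the count data (2.48)/(2.57) CONSTRUCTED on the (k+1)-level tower; the repaired Lemma 2.1 with
the L-free two-scale constant on every tower.
-/
import Mathlib
import Literature.MathematicalPhysics.QuantumFieldTheory.Balaban1983to89.B6LevelTower
import Literature.MathematicalPhysics.QuantumFieldTheory.Balaban1983to89.B6Lemma21Bridge

/-!
# [B6] THE DECOMPOSITION (2.47) OF A SHORTEST ADMISSIBLE CONTOUR, WITH (2.48), (2.57) AND THE RECONSTRUCTION BEHIND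
# (2.58), CONSTRUCTED ON THE (k+1)-LEVEL TOWER — `B6Lemma21Bridge.Decomp247 (B6LevelTower.twGeo …) d y` for every
# base point (census hypothesis H-B6.1 discharged there), hence Lemma 2.1 (2.61″) with the L-FREE constant
# c₁″ = 13c₀(½α)^{4d} on every tower and `B6Lemma21TwoScale.Lemma21TwoScale` on every tower family

CITATION HEADER (unit b2b-balaban-b06-g24, gen 24 of the B06 lineage; the imported modules are not modified).  Source:
T. Bałaban, *Propagators and renormalization transformations for lattice gauge theories. II*, Commun. Math. Phys. **96**
(1984) 223–250 [Balaban1984PropagatorsII] (= [B6]).  Renders read AS IMAGES this generation: p. 231 ((2.45)–(2.47) and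
the paragraph between them), p. 232 ((2.48)), p. 233 ((2.54)–(2.59), c₀).  The abstract typing of the decomposition data
(`Decomp247`) and the bridge (2.47) ⟹ (2.61″) are those of `B6Lemma21Bridge` (this lineage), whose header certifies
the same pages.

THE PRINTED TEXT (verbatim).  p. 231: *"For an arbitrary contour Γ on the lattice T_η we put |Γ| = nη, where n is a
number of bonds the contour Γ consists of. … They have the property that a part of Γ contained in B^j(Λ_j) consists of
bonds of the lattice Λ_j. Now we define d(y, y′) = inf_{Γ_{y,y′}} Σ_{j=0}^{k} (L^jη)^{−1}|Γ_{y,y′} ∩ B^j(Λ_j)|, y, y′ ∈ 𝔅,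
(2.46) … The surface Σ_j separates the sets B^j(Λ_j) and B^{j−1}(Λ_{j−1}). Now let us consider the definition (2.46). Of
course the infimum is attained at some contour Γ_{y,y′}. Let us assume that y ∈ Λ_j, y′ ∈ Λ_{j′}. … The contour Γ_{y,y′}
starts at y and intersects either the surface Σ_j, or the surface Σ_{j+1}, the first time at a point y₁. Let us denote
the index of the surface by j₁, so y₁ ∈ Σ_{j₁}. A next portion of the contour Γ_{y₁,y′} starting at y₁ is contained in
one of the domains B^{j₁}(Λ_{j₁}), B^{j₁−1}(Λ_{j₁−1}), and intersects one of the surfaces Σ_{j₁−1}, Σ_{j₁}, Σ_{j₁+1} the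
first time at a point y′₁. If this point belongs to Σ_{j₁}, then we consider a next portion of the contour in the same
way and we denote by y′₁ the last intersection point of the contour Γ_{y₁,y′} with the surface Σ_{j₁}. More exactly it
is such a point of the contour Γ_{y₁,y′} that y′₁ ∈ Σ_{j₁}, the portion Γ_{y₁,y′₁} of the contour does not intersect any
surface Σ_j with j ≠ j₁, and it is the last point of the contour with this property. If the point belongs to one of the
surfaces Σ_{j₁−1}, Σ_{j₁+1}, then we denote it by y₂ and we denote the index of the surface by j₂. … Thus the portion
Γ_{y′₁,y₂} of the contour Γ_{y₁,y′} connects the surface Σ_{j₁} with the surface Σ_{j₂} and is contained in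
B^{j₁₂}(Λ_{j₁₂}), j₁₂ = min{j₁, j₂}, moreover |j₁ − j₂| = 1. … Continuing this way we obtain a sequence of points y,
y₁, y′₁, y₂, y′₂, …, y_m, y′_m, y′ on Γ_{y,y′}, and a sequence of indices j, j₁, j₂, …, j_m, j′ with the following
properties: Γ_{y,y′} = Γ_{y,y₁} ∪ ⋃_{l=1}^{m} (Γ_{y_l,y′_l} ∪ Γ_{y′_l,y_{l+1}}), y_{m+1} = y′, (2.47) y_l, y′_l ∈ Σ_{j_l},
Γ_{y_l,y′_l} does not intersect any other surface Σ_j, j ≠ j_l, Γ_{y′_l,y_{l+1}} connects the surface Σ_{j_l} with the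
surface Σ_{j_{l+1}} and is contained in B^{j_{l,l+1}}(Λ_{j_{l,l+1}}), where j_{l,l+1} = min{j_l, j_{l+1}},
|j_l − j_{l+1}| = 1."*  p. 232: *"From this decomposition and the definition (2.46) we get d(y, y′) ≥
(L^jη)^{−1}|Γ_{y,y₁}| + Σ_{l=1}^{m} (L^{j_l}η)^{−1}|Γ_{y_l,y′_l}| + Σ_{l=1}^{m} (L^{j_{l,l+1}}η)^{−1}|Γ_{y′_l,y_{l+1}}| ≥
(L^jη)^{−1}|y − y₁| + Σ_{l=1}^{m} (L^{j_l}η)^{−1}|y_l − y′_l| + Σ_{l=1}^{m} (L^{j_{l,l+1}}η)^{−1}|y′_l − y_{l+1}|.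
(2.48)"*  p. 233: *"From the condition (2.2) and from the definition of the points y′_l, y_{l+1}, more exactly from the
fact that they belong to different surfaces Σ_j, we have (L^{j_{l,l+1}}η)^{−1}|y′_l − y_{l+1}| > RM. (2.57) The distances
on the right-hand side of (2.48) are scaled to unit lattice and we estimate e^{−αδ₀d(y,y′)} using (2.48) and adding sums
over all intermediate points y_l, y′_l, l = 1, …, m, and over all possible numbers m. We get Σ_{y′∈𝔅} e^{−αδ₀d(y,y′)}
= … = Σ_{j′=0}^{k} Σ_{m=max{|j−j′|−1,0}}^{∞} e^{−½αδ₀mRM}(c₀(1/2α))^{d(2m+1)}, (2.58) where s(y) denotes a scaled image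
of y on unit lattice … Now we require that RM is sufficiently large, i.e. we assume ¼αδ₀RM > 2d log c₀(½α) + 1.
(2.59)"*.

THE POINT.  The kernel bridge `B6Lemma21Bridge.ineq261T_of_decomp` derives the repaired (2.61″)
sup_y Σ_{y′} e^{−αδ₀d(y,y′)} ≤ c₁″ = 13c₀(½α)^{4d} — a constant depending on d, δ₀, α ONLY — from decomposition DATA
`Decomp247 g d y`: per end-point y′ the number m of surface episodes, the walls (j_l) with |j_{l+1} − j_l| = 1 (hstep),
|j₁ − j| ≤ 1 (hfirst), |j_m − j′| ≤ 1 (hlast), j′ = j if m = 0 (hzero), the separation RM(m − 1) ≤ d(y, y′) ((2.57),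
hsep), coded legs of total length ≤ d(y, y′) ((2.48), hwt), and the RECONSTRUCTION (hinj): y′ of given level is
determined by m, the scale-blind code of Γ_{y,y₁}, the two-scale (coarse ∕ fine) codes of the surface legs, and the
branch signs of (j_l).  So far this structure was a HYPOTHESIS everywhere (census H-B6.1; the binder `hdecomp` of
`DagDischarged`; never instantiated on any geometry), and the only unconditional (2.61) on the (k+1)-level tower was the
direct single-scale count `B6TowerSums.twGeo_ineq261With` whose constant K_tw carries L (DIVERGENCE D-b06.41 (a):
*"the true tower constant is presumably L-free too … but that needs a leg code across ≥ 3 scales … — not built"*).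
This leaf CONSTRUCTS the data on `B6LevelTower.twGeo d k a M L η R` for every base point, by reading the quoted
paragraph of p. 231 literally on a shortest admissible contour: (§4) the ENCODER walks along the contour; an in-box
Λ_c-bond is a unit step of the current leg (flagged fine iff c is the lower box of the current wall); a wall bond through
the CURRENT wall Σ_w continues the episode (y′_l = the last point on Σ_{j_l} before another surface); a wall bond through
ANOTHER wall opens the next episode (y_{l+1}, j_{l+1}); (§5) the DECODER recovers positions: an episode at Σ_w started
at level c with coarse code C and fine code F ends at P + L^w C + L^{w−1} F + (c_end − c)L^{w−1}e₀ (`decS_enc`, proved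
for EVERY admissible contour by induction along it — the surfaces being disjoint hyperplanes {x₀ = const}, wall bonds
move by ±L^{w−1}e₀ only); (§6) consecutive episodes sit at neighbouring surfaces, the first at Σ_j or Σ_{j+1}, the last at
a surface of the final box; (§7) the legs code at most d(y, y′) bonds ((2.48)), and between the starts of two
consecutive episodes lie ≥ a + 1 bonds — a potential argument: after crossing into a box at one face, a e₀-steps are
needed to reach the other face ((2.57) with RM ≤ a + 1, the tower's (2.2): `B6LevelTower.twGeo_levelSep`); the first
wall is decided by a FACE TEST on the decoded y₁ (far face x₀ = off_j + aL^j ⟺ exit through Σ_{j+1}; needs a ≥ 1,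
L ≥ 1), the later walls by the branch signs; positions separate sites of one level (`eq_of_pos_eq`, L ≥ 1).  (§9) Hence
H-B6.1 holds on the tower (`decomp247`), (2.61″) with c₁″ INDEPENDENT OF L, k, a, M, R under (2.59) (`twGeo_ineq261T`,
`tower_sum_exp_le`), `Lemma21TwoScale` on every family of towers (`lemma21TwoScale_towers`: (2.60) by the level gap of
`B6LevelTower`, (2.61″) by the construction), and non-vacuity (`towerDecomp_nonvacuous`: for all d, k, L ≥ 1, η,
δ₀ > 0, α > 0 some tower meets RM ≤ a + 1 and (2.59) — by Archimedes, no bound on c₀ used).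

WHAT THIS MODULE PROVES.  §1 contours as vertex chains (`IsPath`, `lastV`, `exists_isPath_length_eq_dist`).  §2 steps
(`svec`, `stepOf`, `svec_stepOf`, `pathV_cons`, `twoScale_step`).  §3 tower bonds (`adj_cases`, `pos_inbox`, `pos_wall`,
`pos_zero_of_far ∕ _near`, `eq_of_pos_eq`, `idx0_step`).  §4 the code and the encoder (`Code`, `enc`, `Inv`).  §5 the
decoder and the reconstruction theorem (`decA`, `decS`, `decA_shift`, `decS_enc`).  §6 walls (`WAdj`, `enc_head_wadj`,
`enc_walls_wadj`, `enc_head_top`, `lastW`, `enc_lastW`, `enc_top_noRuns`).  §7 counting (`enc_length_le`, `Φ`,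
`enc_runs_bound`, `enc_head_face`, `map_eq_map_of_getD`).  §8 shortest contours and the seven fields on the tower
(`spath`, `tower_hstep ∕ hfirst ∕ hlast ∕ hzero ∕ hsep ∕ hwt ∕ hinj`).  §9 `decomp247`, `twGeo_ineq261T`,
`tower_sum_exp_le`, `lemma21TwoScale_towers`, `cond259_witness`, `towerDecomp_nonvacuous`.

TYPING ∕ DIVERGENCE (D-b06.44).  (i) legX ≡ []: the crossing leg Γ_{y′_l,y_{l+1}} is coded together with the surface
leg of episode l at the two scales of Σ_{j_l} (its box IS one of the two boxes of Σ_{j_l}); `Decomp247` types the three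
legs separately but constrains only their total length and the injectivity, so this is an instance, and the count of
`ineq261T_of_decomp` charges c₀^{2d} per surface leg and c₀^d per crossing leg regardless.  (ii) m counts EPISODES
(maximal runs of crossings of one surface), exactly print's y_l … y′_l convention (*"the last intersection point … with
this property"*); counting wall bonds instead would break (2.57).  (iii) The tower's d(y, y′) is the bond count of
(2.46) with unit weights per Λ_j-bond (`B6LevelTower.tdist`), wall bonds weighing 1 as well (print: the step from Σ_j
into the next box is a Λ-bond of one of the two lattices) — as fixed in gen 20 (D-b06.40 (c)).  (iv) RM ≤ a + 1 replaces
print's (2.2) (big blocks of side ML^jη inside Ω_j, R of them between Σ_j and Σ_{j+1}); on the tower the two surfaces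
of box j are its faces x₀ = 0 and x₀ = a.  (v) The printed c₁ = 12c₀(½α)^d stays refuted as typed
(`B6Lemma21Counterexample`); c₁″ is the lineage's corrected constant (G-A13-1), now REALISED on a multi-level
geometry with content (k interfaces, L ≥ 1 arbitrary).  (vi) The L-free constant is bought with (2.59) — exactly
print's trade — whereas the L-dependent K_tw of `B6TowerSums` needs no largeness of RM (D-b06.41 (b)); both stand.

HONEST SCOPE.  Combinatorial ∕ modelling leaf: print's decomposition (2.47) and the injectivity behind the count (2.58)
made into a kernel object on the coordinatised tower, discharging H-B6.1 there and giving Lemma 2.1 with an L-free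
constant on every tower.  NOT summit progress (no statement about continuum Yang–Mills or a mass gap is touched), NOT
the decomposition on a general region geometry {Ω_j} of a torus (only the tower family), NOT the printed constant c₁,
NOT a Clay-level claim.
-/

namespace Literature.MathematicalPhysics.QuantumFieldTheory.Balaban1983to89.B6TowerDecomp

open Finset
open Literature.Probability.LatticeModels (Site zdGraph zdGraph_adj_iff)
open B6LevelTower
open B6Lemma21Bridge (Step pathC pathF pathV Decomp247)
open B6CoverTwoLevel (zv zv_step zv_mem_Icc)

/-! ## §1  Chains of admissible bonds (contours as vertex lists) -/

section Chains

variable {V : Type*}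

/-- The end-point of a contour given as its start and the list of the subsequent vertices. [folklore] -/
def lastV : V → List V → V
  | u, [] => u
  | _, v :: rest => lastV v rest

/-- A contour: consecutive vertices are joined by bonds of `G`. [folklore] -/
def IsPath (G : SimpleGraph V) : V → List V → Prop
  | _, [] => True
  | u, v :: rest => G.Adj u v ∧ IsPath G v rest

/-- A walk of the bond graph is a contour in the list form, of the same number of bonds. [folklore] -/
theorem exists_isPath_of_walk {G : SimpleGraph V} :
    ∀ {u v : V} (W : G.Walk u v), ∃ l : List V, IsPath G u l ∧ lastV u l = v ∧ l.length = W.length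
  | _, _, .nil => ⟨[], trivial, rfl, rfl⟩
  | _, _, .cons h p => by
      obtain ⟨l, hc, hl, hlen⟩ := exists_isPath_of_walk p
      exact ⟨_ :: l, ⟨h, hc⟩, hl, by simp [hlen]⟩

/-- In a connected graph two vertices are joined by a contour with exactly `dist` bonds (*"Of course the infimum is
attained at some contour Γ_{y,y′}"*, p. 231). [cite: Balaban1984PropagatorsII, (2.46) p.231] -/
theorem exists_isPath_length_eq_dist {G : SimpleGraph V} (hG : G.Connected) (u v : V) :
    ∃ l : List V, IsPath G u l ∧ lastV u l = v ∧ l.length = G.dist u v := by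
  obtain ⟨W, hW⟩ := hG.exists_walk_length_eq_dist u v
  obtain ⟨l, h1, h2, h3⟩ := exists_isPath_of_walk W
  exact ⟨l, h1, h2, h3.trans hW⟩

end Chains

/-! ## §2  Steps of a leg: the scale-blind unit vector, the step read off an in-box bond -/

section Steps

variable {d : ℕ}

/-- The signed unit vector of a step, read scale-blind. [folklore] -/
def svec (s : Step d) : Fin d → ℤ := fun i => if i = s.dir then s.sign else 0

/-- cvec + fvec = the scale-blind unit vector. [folklore] -/
theorem cvec_add_fvec (s : Step d) : s.cvec + s.fvec = svec s := by
  funext i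
  cases hf : s.fine <;> simp [Step.cvec, Step.fvec, svec, hf]

/-- A coarse step contributes its vector to the coarse count only. [folklore] -/
theorem cvec_of_fine_false (s : Step d) (h : s.fine = false) : s.cvec = svec s := by
  funext i; simp [Step.cvec, svec, h]

/-- A coarse step contributes nothing to the fine count. [folklore] -/
theorem fvec_of_fine_false (s : Step d) (h : s.fine = false) : s.fvec = 0 := by
  funext i; simp [Step.fvec, h]

/-- A fine step contributes nothing to the coarse count. [folklore] -/
theorem cvec_of_fine_true (s : Step d) (h : s.fine = true) : s.cvec = 0 := by
  funext i; simp [Step.cvec, h]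

/-- A fine step contributes its vector to the fine count only. [folklore] -/
theorem fvec_of_fine_true (s : Step d) (h : s.fine = true) : s.fvec = svec s := by
  funext i; simp [Step.fvec, svec, h]

/-- pathV of a leg with one more bond. [folklore] -/
theorem pathV_cons (s : Step d) (p : List (Step d)) : pathV (s :: p) = svec s + pathV p := by
  show (s.cvec + pathC p) + (s.fvec + pathF p) = svec s + (pathC p + pathF p)
  rw [← cvec_add_fvec]; abel

/-- pathC of a leg with one more bond. [folklore] -/
theorem pathC_cons (s : Step d) (p : List (Step d)) : pathC (s :: p) = s.cvec + pathC p := rfl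

/-- pathF of a leg with one more bond. [folklore] -/
theorem pathF_cons (s : Step d) (p : List (Step d)) : pathF (s :: p) = s.fvec + pathF p := rfl

/-- The empty leg codes 0 (coarse). [folklore] -/
theorem pathC_nil : pathC ([] : List (Step d)) = 0 := rfl

/-- The empty leg codes 0 (fine). [folklore] -/
theorem pathF_nil : pathF ([] : List (Step d)) = 0 := rfl

/-- The empty leg codes 0. [folklore] -/
theorem pathV_nil : pathV ([] : List (Step d)) = 0 := by
  show pathC [] + pathF [] = (0 : Fin d → ℤ); rw [pathC_nil, pathF_nil, add_zero]

variable [NeZero d]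

/-- The step read off a nearest-neighbour bond x → x′ of a lattice (direction and orientation), flagged coarse or fine.
[folklore] -/
noncomputable def stepOf (x x' : Fin d → ℤ) (b : Bool) : Step d :=
  if h : ∃ i, x' = x + Pi.single i 1 then ⟨h.choose, b, false⟩
  else if h' : ∃ i, x = x' + Pi.single i 1 then ⟨h'.choose, b, true⟩
  else ⟨0, b, false⟩

/-- The flag of the step read off a bond is the prescribed one. [folklore] -/
theorem stepOf_fine (x x' : Fin d → ℤ) (b : Bool) : (stepOf x x' b).fine = b := by
  unfold stepOf; split_ifs <;> rfl

/-- The step read off a bond x → x′ has vector x′ − x. [folklore] -/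
theorem svec_stepOf {x x' : Fin d → ℤ} (h : (zdGraph d).Adj x x') (b : Bool) : svec (stepOf x x' b) = x' - x := by
  unfold stepOf
  split_ifs with h1 h2
  · have hi := h1.choose_spec
    generalize h1.choose = i at hi ⊢
    funext j
    rw [hi]
    by_cases hj : j = i
    · subst hj; simp [svec, Step.sign]
    · simp [svec, hj]
  · have hi := h2.choose_spec
    generalize h2.choose = i at hi ⊢
    funext j
    rw [hi]
    by_cases hj : j = i
    · subst hj; simp [svec, Step.sign]
    · simp [svec, hj]
  · exfalso
    rcases (zdGraph_adj_iff x x').1 h with ⟨i, hi | hi⟩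
    · exact h1 ⟨i, hi⟩
    · exact h2 ⟨i, hi⟩

omit [NeZero d] in
/-- Two-scale reading of one in-box bond of level c relative to the wall w ∈ {c, c + 1}: flagged fine iff the box is the
lower box of the wall, the bond contributes L^c·(its vector) to L^w·pathC + L^{w−1}·pathF. [cite:
Balaban1984PropagatorsII, (2.46)–(2.47) p.231] -/
theorem twoScale_step (L : ℕ) (s : Step d) {w c : ℕ} (hcw : c = w ∨ c + 1 = w)
    (hf : s.fine = decide (w = c + 1)) :
    (L : ℤ) ^ w • s.cvec + (L : ℤ) ^ (w - 1) • s.fvec = (L : ℤ) ^ c • svec s := by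
  by_cases h : w = c + 1
  · have hft : s.fine = true := by rw [hf]; simp [h]
    rw [cvec_of_fine_true _ hft, fvec_of_fine_true _ hft, h, Nat.add_sub_cancel, smul_zero, zero_add]
  · have hc : c = w := by omega
    have hff : s.fine = false := by rw [hf]; simp [h]
    rw [cvec_of_fine_false _ hff, fvec_of_fine_false _ hff, hc, smul_zero, add_zero]

end Steps

/-! ## §3  Bonds of the tower: classification and position identities -/

section Bonds

variable {d k a : ℕ} [NeZero d]

/-- An admissible bond of the tower is an in-box Λ_j-bond, a wall bond upwards, or a wall bond downwards.
[cite: Balaban1984PropagatorsII, (2.46) p.231] -/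
theorem adj_cases {L : ℕ} {u v : TW d k a} (h : (graph L).Adj u v) :
    (lvl u = lvl v ∧ (zdGraph d).Adj (zv u.2) (zv v.2)) ∨
    (lvl v = lvl u + 1 ∧ (u.2 0 : ℕ) = a ∧ (v.2 0 : ℕ) = 0 ∧ ∀ μ, μ ≠ 0 → zv u.2 μ = (L : ℤ) * zv v.2 μ) ∨
    (lvl u = lvl v + 1 ∧ (v.2 0 : ℕ) = a ∧ (u.2 0 : ℕ) = 0 ∧ ∀ μ, μ ≠ 0 → zv v.2 μ = (L : ℤ) * zv u.2 μ) := by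
  rw [graph, SimpleGraph.fromRel_adj] at h
  rcases h.2 with h' | h'
  · rcases h' with ⟨h1, h2⟩ | h''
    · exact Or.inl ⟨congrArg Fin.val h1, h2⟩
    · exact Or.inr (Or.inl h'')
  · rcases h' with ⟨h1, h2⟩ | h''
    · exact Or.inl ⟨(congrArg Fin.val h1).symm, h2.symm⟩
    · exact Or.inr (Or.inr h'')

/-- Along an in-box Λ_j-bond the position moves by L^j times the bond vector. [cite: Balaban1984PropagatorsII, (2.46) p.231] -/
theorem pos_inbox (L : ℕ) {u v : TW d k a} (h : lvl u = lvl v) (i : Fin d) :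
    pos L v i = pos L u i + (L : ℤ) ^ lvl u * (zv v.2 i - zv u.2 i) := by
  simp only [pos, h]; ring

/-- Along a wall bond upwards the position moves by +L^j e₀. [cite: Balaban1984PropagatorsII, (2.46) p.231] -/
theorem pos_wallUp (L : ℕ) {u v : TW d k a} (h1 : lvl v = lvl u + 1) (h2 : (u.2 0 : ℕ) = a) (h3 : (v.2 0 : ℕ) = 0)
    (h4 : ∀ μ, μ ≠ 0 → zv u.2 μ = (L : ℤ) * zv v.2 μ) (i : Fin d) :
    pos L v i = pos L u i + (if i = 0 then (L : ℤ) ^ lvl u else 0) := by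
  by_cases hi : i = 0
  · subst hi
    have hz : zv u.2 0 = (a : ℤ) := by simp [zv, h2]
    have hz' : zv v.2 0 = 0 := by simp [zv, h3]
    simp only [pos, if_true, h1, off_succ, hz, hz']; ring
  · simp only [pos, hi, if_false, zero_add, h1, h4 i hi, pow_succ, add_zero]; ring

/-- Along a wall bond (either orientation) the position moves by (j(v) − j(u))·L^{max(j(u),j(v))−1} e₀.
[cite: Balaban1984PropagatorsII, (2.46) p.231] -/
theorem pos_wall {L : ℕ} {u v : TW d k a} (h : (graph L).Adj u v) (hne : lvl u ≠ lvl v) (i : Fin d) :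
    pos L v i = pos L u i +
      (if i = 0 then ((lvl v : ℤ) - lvl u) * (L : ℤ) ^ (max (lvl u) (lvl v) - 1) else 0) := by
  rcases adj_cases h with ⟨hl, -⟩ | ⟨h1, h2, h3, h4⟩ | ⟨h1, h2, h3, h4⟩
  · exact absurd hl hne
  · rw [pos_wallUp L h1 h2 h3 h4 i, h1]
    have hm : max (lvl u) (lvl u + 1) - 1 = lvl u := by omega
    rw [hm]
    split_ifs <;> push_cast <;> ring
  · have := pos_wallUp L h1 h2 h3 h4 i
    rw [this, h1]
    have hm : max (lvl v + 1) (lvl v) - 1 = lvl v := by omega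
    rw [hm]
    split_ifs <;> push_cast <;> ring

/-- The start of a wall bond upwards sits on the far face: x₀ = off_j + aL^j. [folklore] -/
theorem pos_zero_of_far {L : ℕ} {u : TW d k a} (h2 : (u.2 0 : ℕ) = a) :
    pos L u 0 = off L a (lvl u) + (a : ℤ) * (L : ℤ) ^ lvl u := by
  have hz : zv u.2 0 = (a : ℤ) := by simp [zv, h2]
  simp only [pos, if_true, hz]; ring

/-- The start of a wall bond downwards sits on the near face: x₀ = off_j. [folklore] -/
theorem pos_zero_of_near {L : ℕ} {u : TW d k a} (h3 : (u.2 0 : ℕ) = 0) : pos L u 0 = off L a (lvl u) := by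
  have hz : zv u.2 0 = 0 := by simp [zv, h3]
  simp only [pos, if_true, hz]; ring

/-- **Positions separate the sites of one level** (L ≥ 1): the scaled image determines the point.
[cite: Balaban1984PropagatorsII, (2.58) p.233 (*"s(y) denotes a scaled image of y on unit lattice"*)] -/
theorem eq_of_pos_eq {L : ℕ} (hL : 1 ≤ L) {y y' : TW d k a} (hl : lvl y = lvl y') (hp : pos L y = pos L y') :
    y = y' := by
  obtain ⟨z, x⟩ := y
  obtain ⟨z', x'⟩ := y'
  have hz : z = z' := Fin.ext hl
  subst hz
  have hx : x = x' := by
    funext μ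
    have h1 := congr_fun hp μ
    simp only [pos, lvl] at h1
    have hLz : (L : ℤ) ^ (z : ℕ) ≠ 0 := pow_ne_zero _ (by exact_mod_cast (show L ≠ 0 by omega))
    have h2 : zv x μ = zv x' μ := mul_left_cancel₀ hLz (by linarith)
    simp only [zv, Nat.cast_inj] at h2
    exact Fin.ext h2
  rw [hx]

/-- Along an in-box bond the x₀-index changes by at most one. [folklore] -/
theorem idx0_step {x x' : Fin d → Fin (a + 1)} (h : (zdGraph d).Adj (zv x) (zv x')) :
    (x 0 : ℕ) ≤ (x' 0 : ℕ) + 1 ∧ (x' 0 : ℕ) ≤ (x 0 : ℕ) + 1 := by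
  obtain ⟨μ, hμ, h1⟩ := zv_step h
  have e0 : zv x 0 = ((x 0 : ℕ) : ℤ) := rfl
  have e0' : zv x' 0 = ((x' 0 : ℕ) : ℤ) := rfl
  by_cases h0 : (0 : Fin d) = μ
  · rw [← h0, e0, e0'] at h1
    constructor <;> [skip; skip] <;> (rcases abs_eq (by norm_num : (0:ℤ) ≤ 1) |>.1 h1 with h | h <;> omega)
  · have := hμ 0 h0
    rw [e0, e0'] at this
    omega

end Bonds

/-! ## §4  The coding of a contour: legs, surface episodes, the encoder -/

section Coding

variable {d k a : ℕ} [NeZero d]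

/-- The code of a contour suffix: the steps before the next surface episode starts (`pre`), then the episodes in order,
each with the index of its wall Σ_w and the two-scale-flagged in-box steps until the following episode starts.
[cite: Balaban1984PropagatorsII, (2.47) p.231] -/
structure Code (d : ℕ) where
  /-- the in-box steps before the next episode (for the whole contour: the leg Γ_{y,y₁}) -/
  pre : List (Step d)
  /-- the episodes: wall index j_l and the flagged steps of Γ_{y_l,y′_l} ∪ Γ_{y′_l,y_{l+1}} -/
  runs : List (ℕ × List (Step d))

/-- **The encoder** (p. 231, the paragraph before (2.47), read literally): walk along the contour keeping the wall Σ_w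
of the current episode; an in-box bond is a step of the current leg (flagged fine iff its box is the lower box of the
current wall); a wall bond through the CURRENT wall costs nothing (the episode continues — *"y′₁ the last intersection
point … the portion Γ_{y₁,y′₁} does not intersect any surface Σ_j with j ≠ j₁"*); a wall bond through ANOTHER wall starts
the next episode (*"then we denote it by y₂ and we denote the index of the surface by j₂"*).
[cite: Balaban1984PropagatorsII, (2.47) p.231] -/
noncomputable def enc : TW d k a → List (TW d k a) → Option ℕ → Code d
  | _, [], _ => ⟨[], []⟩
  | u, v :: rest, st =>
    if lvl u = lvl v then
      ⟨stepOf (zv u.2) (zv v.2) (decide (st = some (lvl u + 1))) :: (enc v rest st).pre, (enc v rest st).runs⟩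
    else if st = some (max (lvl u) (lvl v)) then enc v rest st
    else ⟨[], (max (lvl u) (lvl v), (enc v rest (some (max (lvl u) (lvl v)))).pre) ::
            (enc v rest (some (max (lvl u) (lvl v)))).runs⟩

/-- Encoder, no bonds left. [folklore] -/
theorem enc_nil (u : TW d k a) (st : Option ℕ) : enc u [] st = ⟨[], []⟩ := rfl

/-- Encoder, an in-box bond. [folklore] -/
theorem enc_inbox {u v : TW d k a} (rest : List (TW d k a)) (st : Option ℕ) (h : lvl u = lvl v) :
    enc u (v :: rest) st =
      ⟨stepOf (zv u.2) (zv v.2) (decide (st = some (lvl u + 1))) :: (enc v rest st).pre, (enc v rest st).runs⟩ := by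
  rw [enc, if_pos h]

/-- Encoder, a wall bond through the current wall. [folklore] -/
theorem enc_same {u v : TW d k a} (rest : List (TW d k a)) {st : Option ℕ} (h : lvl u ≠ lvl v)
    (hs : st = some (max (lvl u) (lvl v))) : enc u (v :: rest) st = enc v rest st := by
  rw [enc, if_neg h, if_pos hs]

/-- Encoder, a wall bond starting a new episode. [folklore] -/
theorem enc_new {u v : TW d k a} (rest : List (TW d k a)) {st : Option ℕ} (h : lvl u ≠ lvl v)
    (hs : st ≠ some (max (lvl u) (lvl v))) :
    enc u (v :: rest) st = ⟨[], (max (lvl u) (lvl v), (enc v rest (some (max (lvl u) (lvl v)))).pre) ::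
      (enc v rest (some (max (lvl u) (lvl v)))).runs⟩ := by
  rw [enc, if_neg h, if_neg hs]

/-- Encoder, an in-box bond: the episodes. [folklore] -/
theorem enc_inbox_runs {u v : TW d k a} (rest : List (TW d k a)) (st : Option ℕ) (h : lvl u = lvl v) :
    (enc u (v :: rest) st).runs = (enc v rest st).runs := by
  rw [enc_inbox rest st h]

/-- Encoder, an in-box bond: the pending leg. [folklore] -/
theorem enc_inbox_pre {u v : TW d k a} (rest : List (TW d k a)) (st : Option ℕ) (h : lvl u = lvl v) :
    (enc u (v :: rest) st).pre = stepOf (zv u.2) (zv v.2) (decide (st = some (lvl u + 1))) :: (enc v rest st).pre := by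
  rw [enc_inbox rest st h]

/-- Encoder, a new episode: the episodes. [folklore] -/
theorem enc_new_runs {u v : TW d k a} (rest : List (TW d k a)) {st : Option ℕ} (h : lvl u ≠ lvl v)
    (hs : st ≠ some (max (lvl u) (lvl v))) :
    (enc u (v :: rest) st).runs = (max (lvl u) (lvl v), (enc v rest (some (max (lvl u) (lvl v)))).pre) ::
      (enc v rest (some (max (lvl u) (lvl v)))).runs := by
  rw [enc_new rest h hs]

/-- Encoder, a new episode: nothing pending. [folklore] -/
theorem enc_new_pre {u v : TW d k a} (rest : List (TW d k a)) {st : Option ℕ} (h : lvl u ≠ lvl v)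
    (hs : st ≠ some (max (lvl u) (lvl v))) : (enc u (v :: rest) st).pre = [] := by
  rw [enc_new rest h hs]

/-- The bookkeeping invariant of the encoder: the current box is one of the two boxes of the current wall.
[cite: Balaban1984PropagatorsII, p.231 (*"Σ_j separates the sets B^j(Λ_j) and B^{j−1}(Λ_{j−1})"*)] -/
def Inv (u : TW d k a) (st : Option ℕ) : Prop := ∀ w, st = some w → lvl u = w ∨ lvl u + 1 = w

omit [NeZero d] in
/-- The invariant with no episode open. [folklore] -/
theorem inv_none (u : TW d k a) : Inv u none := by
  intro w h; cases h

omit [NeZero d] in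
/-- The invariant along an in-box bond. [folklore] -/
theorem inv_inbox {u v : TW d k a} {st : Option ℕ} (h : Inv u st) (hl : lvl u = lvl v) : Inv v st :=
  fun w hw => by rw [← hl]; exact h w hw

/-- The invariant after a wall bond (either orientation), episode at that wall. [folklore] -/
theorem inv_wall {L : ℕ} {u v : TW d k a} (h : (graph L).Adj u v) (hne : lvl u ≠ lvl v) :
    Inv v (some (max (lvl u) (lvl v))) := by
  intro w hw
  simp only [Option.some.injEq] at hw
  rcases adj_cases h with ⟨hl, -⟩ | ⟨h1, -⟩ | ⟨h1, -⟩
  · exact absurd hl hne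
  · left; rw [← hw, h1, max_eq_right (Nat.le_succ _)]
  · right; rw [← hw, h1, max_eq_left (Nat.le_succ _)]

end Coding

/-! ## §5  The decoder and the reconstruction theorem -/

section Decoding

variable {d k a : ℕ} [NeZero d]

/-- e₀. [folklore] -/
def e0 : Fin d → ℤ := fun i => if i = 0 then 1 else 0

/-- The level at which the episode at wall w ends: the box between w and the next wall, or the final level.
[cite: Balaban1984PropagatorsII, (2.47) p.231 (*"contained in B^{j_{l,l+1}}(Λ_{j_{l,l+1}}), j_{l,l+1} = min{j_l, j_{l+1}}"*)] -/
def nextLvl (w : ℕ) (rs : List (ℕ × (Fin d → ℤ) × (Fin d → ℤ))) (jf : ℕ) : ℕ :=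
  match rs with
  | [] => jf
  | r :: _ => min w r.1

/-- **The decoder** on abstract episode data (wall, coarse code, fine code): from the position and level at the start
of an episode at wall w, the end position is P + L^w·C + L^{w−1}·F + (net number of crossings)·L^{w−1}e₀, the net
number of crossings being (end level) − (start level) ∈ {−1, 0, 1}. [cite: Balaban1984PropagatorsII, (2.58) p.233] -/
def decA (L : ℕ) : (Fin d → ℤ) → ℕ → List (ℕ × (Fin d → ℤ) × (Fin d → ℤ)) → ℕ → (Fin d → ℤ)
  | P, _, [], _ => P
  | P, c, (w, C, F) :: rs, jf =>
      decA L (P + (L : ℤ) ^ w • C + (L : ℤ) ^ (w - 1) • F +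
          (((nextLvl w rs jf : ℕ) : ℤ) - c) • ((L : ℤ) ^ (w - 1) • e0)) (nextLvl w rs jf) rs jf

/-- One decoding step. [folklore] -/
theorem decA_cons (L : ℕ) (P : Fin d → ℤ) (c w : ℕ) (C F : Fin d → ℤ) (rs : List (ℕ × (Fin d → ℤ) × (Fin d → ℤ)))
    (jf : ℕ) : decA L P c ((w, C, F) :: rs) jf =
      decA L (P + (L : ℤ) ^ w • C + (L : ℤ) ^ (w - 1) • F +
          (((nextLvl w rs jf : ℕ) : ℤ) - c) • ((L : ℤ) ^ (w - 1) • e0)) (nextLvl w rs jf) rs jf := rfl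

/-- The abstract data of an episode: its wall and its two codes. [folklore] -/
def absRun (r : ℕ × List (Step d)) : ℕ × (Fin d → ℤ) × (Fin d → ℤ) := (r.1, pathC r.2, pathF r.2)

omit [NeZero d] in
/-- absRun on a pair. [folklore] -/
theorem absRun_mk (x : ℕ) (p : List (Step d)) : absRun (x, p) = (x, pathC p, pathF p) := rfl

omit [NeZero d] in
/-- nextLvl with a following episode. [folklore] -/
theorem nextLvl_cons (w x : ℕ) (C F : Fin d → ℤ) (rs : List (ℕ × (Fin d → ℤ) × (Fin d → ℤ))) (jf : ℕ) :
    nextLvl w ((x, C, F) :: rs) jf = min w x := rfl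

omit [NeZero d] in
/-- nextLvl with no following episode. [folklore] -/
theorem nextLvl_nil (w : ℕ) (jf : ℕ) : nextLvl (d := d) w [] jf = jf := rfl

/-- The decoder applied to a code, from a state: with no episode open the pending steps are a single-scale leg at the
current level; with an episode open at wall w they continue that episode. [folklore] -/
def decS (L : ℕ) : Option ℕ → ℕ → (Fin d → ℤ) → Code d → ℕ → (Fin d → ℤ)
  | none, c, P, cd, jf => decA L (P + (L : ℤ) ^ c • pathV cd.pre) c (cd.runs.map absRun) jf
  | some w, c, P, cd, jf => decA L P c ((w, pathC cd.pre, pathF cd.pre) :: cd.runs.map absRun) jf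

/-- A wall bond inside an episode does not change the decoded end-point: the start data (pos u, lvl u) and
(pos v, lvl v) of the two ends of a wall bond at the episode's wall decode identically. [folklore] -/
theorem decA_shift {L : ℕ} {u v : TW d k a} (h : (graph L).Adj u v) (hne : lvl u ≠ lvl v) (C F : Fin d → ℤ)
    (rs : List (ℕ × (Fin d → ℤ) × (Fin d → ℤ))) (jf : ℕ) :
    decA L (pos L u) (lvl u) ((max (lvl u) (lvl v), C, F) :: rs) jf =
      decA L (pos L v) (lvl v) ((max (lvl u) (lvl v), C, F) :: rs) jf := by
  rw [decA_cons, decA_cons]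
  congr 1
  funext i
  simp only [Pi.add_apply, Pi.smul_apply, smul_eq_mul, e0, pos_wall h hne i]
  split_ifs <;> ring

/-- **RECONSTRUCTION** (the injectivity behind the count (2.58)): decoding the code of ANY admissible contour from the
position and level of its start returns the position of its end — leg by leg, the surfaces being disjoint.
[cite: Balaban1984PropagatorsII, (2.58) p.233] -/
theorem decS_enc (L : ℕ) : ∀ (rest : List (TW d k a)) (u : TW d k a) (st : Option ℕ),
    Inv u st → IsPath (graph L) u rest →
    decS L st (lvl u) (pos L u) (enc u rest st) (lvl (lastV u rest)) = pos L (lastV u rest)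
  | [], u, st, hinv, _ => by
      cases st with
      | none =>
        show decA L (pos L u + (L : ℤ) ^ lvl u • pathV []) (lvl u) [] (lvl u) = pos L u
        rw [pathV_nil, smul_zero, add_zero]; rfl
      | some w =>
        show decA L (pos L u) (lvl u) [(w, pathC [], pathF [])] (lvl u) = pos L u
        rw [decA_cons, pathC_nil, pathF_nil]
        show pos L u + (L : ℤ) ^ w • (0 : Fin d → ℤ) + (L : ℤ) ^ (w - 1) • (0 : Fin d → ℤ) +
          (((lvl u : ℕ) : ℤ) - lvl u) • ((L : ℤ) ^ (w - 1) • e0) = pos L u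
        rw [smul_zero, smul_zero, sub_self, zero_smul, add_zero, add_zero, add_zero]
  | v :: rest, u, st, hinv, hch => by
      obtain ⟨huv, hch'⟩ := hch
      show decS L st (lvl u) (pos L u) (enc u (v :: rest) st) (lvl (lastV v rest)) = pos L (lastV v rest)
      rcases adj_cases huv with ⟨hl, hadj⟩ | hw
      · -- an in-box bond: one more step of the current leg
        rw [enc_inbox rest st hl]
        have IH := decS_enc L rest v st (inv_inbox hinv hl) hch'
        rw [← IH]
        have hsv := svec_stepOf hadj (decide (st = some (lvl u + 1)))
        set s := stepOf (zv u.2) (zv v.2) (decide (st = some (lvl u + 1))) with hsdef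
        cases st with
        | none =>
          show decA L (pos L u + (L : ℤ) ^ lvl u • pathV (s :: (enc v rest none).pre)) (lvl u)
              ((enc v rest none).runs.map absRun) (lvl (lastV v rest)) =
            decA L (pos L v + (L : ℤ) ^ lvl v • pathV (enc v rest none).pre) (lvl v)
              ((enc v rest none).runs.map absRun) (lvl (lastV v rest))
          rw [← hl]
          congr 1
          funext i
          rw [pathV_cons, hsv]
          simp only [Pi.add_apply, Pi.smul_apply, Pi.sub_apply, smul_eq_mul, pos_inbox L hl i]
          ring
        | some w =>
          show decA L (pos L u) (lvl u) ((w, pathC (s :: (enc v rest (some w)).pre),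
              pathF (s :: (enc v rest (some w)).pre)) :: (enc v rest (some w)).runs.map absRun)
              (lvl (lastV v rest)) =
            decA L (pos L v) (lvl v) ((w, pathC (enc v rest (some w)).pre, pathF (enc v rest (some w)).pre) ::
              (enc v rest (some w)).runs.map absRun) (lvl (lastV v rest))
          rw [← hl, decA_cons, decA_cons]
          congr 1
          have hf : s.fine = decide (w = lvl u + 1) := by
            rw [hsdef, stepOf_fine]; simp
          have key := twoScale_step L s (hinv w rfl) hf
          rw [hsv] at key
          funext i
          have hk := congr_fun key i
          simp only [Pi.add_apply, Pi.smul_apply, Pi.sub_apply, smul_eq_mul, pathC_cons, pathF_cons] at hk ⊢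
          rw [pos_inbox L hl i]
          linear_combination hk
      · -- a wall bond
        have hne : lvl u ≠ lvl v := by rcases hw with ⟨h1, -⟩ | ⟨h1, -⟩ <;> omega
        have hinv' : Inv v (some (max (lvl u) (lvl v))) := inv_wall huv hne
        have IH := decS_enc L rest v _ hinv' hch'
        by_cases hs : st = some (max (lvl u) (lvl v))
        · -- through the current wall: the episode continues
          rw [enc_same rest hne hs, hs]
          rw [← IH]
          exact decA_shift huv hne _ _ _ _
        · -- through another wall: a new episode
          rw [enc_new rest hne hs]
          have step2 : decA L (pos L u) (lvl u) ((max (lvl u) (lvl v), pathC (enc v rest (some (max (lvl u) (lvl v)))).pre,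
              pathF (enc v rest (some (max (lvl u) (lvl v)))).pre) ::
              (enc v rest (some (max (lvl u) (lvl v)))).runs.map absRun) (lvl (lastV v rest)) =
              pos L (lastV v rest) := by
            rw [decA_shift huv hne]; exact IH
          cases st with
          | none =>
            show decA L (pos L u + (L : ℤ) ^ lvl u • pathV []) (lvl u) (List.map absRun ((max (lvl u) (lvl v),
                (enc v rest (some (max (lvl u) (lvl v)))).pre) ::
                (enc v rest (some (max (lvl u) (lvl v)))).runs)) (lvl (lastV v rest)) = pos L (lastV v rest)
            rw [pathV_nil, smul_zero, add_zero, List.map_cons]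
            exact step2
          | some w =>
            have hw' : w ≠ max (lvl u) (lvl v) := fun h => hs (by rw [h])
            have hmin : min w (max (lvl u) (lvl v)) = lvl u := by
              rcases hinv w rfl with h1 | h1 <;> rcases hw with ⟨h2, -⟩ | ⟨h2, -⟩ <;> omega
            show decA L (pos L u) (lvl u) ((w, pathC [], pathF []) :: List.map absRun ((max (lvl u) (lvl v),
                (enc v rest (some (max (lvl u) (lvl v)))).pre) ::
                (enc v rest (some (max (lvl u) (lvl v)))).runs)) (lvl (lastV v rest)) = pos L (lastV v rest)
            rw [List.map_cons, absRun_mk, decA_cons, pathC_nil, pathF_nil, nextLvl_cons, hmin,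
              smul_zero, smul_zero, sub_self, zero_smul, add_zero, add_zero, add_zero]
            exact step2

end Decoding


/-! ## §6  The walls of consecutive episodes; the first and the last episode; no episode -/

section Walls

variable {d k a : ℕ} [NeZero d]

/-- Neighbouring surfaces: |j − j′| = 1. [cite: Balaban1984PropagatorsII, p.231 (*"intersects either Σ_j or Σ_{j+1}"*)] -/
def WAdj (w w' : ℕ) : Prop := w' = w + 1 ∨ w' + 1 = w

/-- Levels of the two ends of a wall bond differ. [folklore] -/
theorem lvl_ne_of_wall {L : ℕ} {u v : TW d k a}
    (hw : (lvl v = lvl u + 1 ∧ (u.2 0 : ℕ) = a ∧ (v.2 0 : ℕ) = 0 ∧ ∀ μ, μ ≠ 0 → zv u.2 μ = (L : ℤ) * zv v.2 μ) ∨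
      (lvl u = lvl v + 1 ∧ (v.2 0 : ℕ) = a ∧ (u.2 0 : ℕ) = 0 ∧ ∀ μ, μ ≠ 0 → zv v.2 μ = (L : ℤ) * zv u.2 μ)) :
    lvl u ≠ lvl v := by
  rcases hw with ⟨h1, -⟩ | ⟨h1, -⟩ <;> omega

/-- Inside an episode at Σ_w, the next NEW episode is at Σ_{w±1}. [cite: Balaban1984PropagatorsII, (2.47) p.231] -/
theorem enc_head_wadj (L : ℕ) : ∀ (rest : List (TW d k a)) (u : TW d k a) (w : ℕ), Inv u (some w) →
    IsPath (graph L) u rest → (enc u rest (some w)).runs ≠ [] → WAdj w ((enc u rest (some w)).runs.getD 0 (0, [])).1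
  | [], u, w, _, _, hne => by simp [enc_nil] at hne
  | v :: rest, u, w, hinv, ⟨huv, hch⟩, hne => by
      rcases adj_cases huv with ⟨hl, -⟩ | hw
      · rw [enc_inbox_runs rest (some w) hl] at hne ⊢
        exact enc_head_wadj L rest v w (inv_inbox hinv hl) hch hne
      · have hne' := lvl_ne_of_wall hw
        by_cases hs : some w = some (max (lvl u) (lvl v))
        · rw [enc_same rest hne' hs] at hne ⊢
          exact enc_head_wadj L rest v w (hs ▸ inv_wall huv hne') hch hne
        · rw [enc_new_runs rest hne' hs, List.getD_cons_zero]
          have hw' : w ≠ max (lvl u) (lvl v) := fun h => hs (by rw [h])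
          have hi := hinv w rfl
          unfold WAdj
          rcases hw with ⟨h1, -⟩ | ⟨h1, -⟩ <;> omega

/-- **Consecutive episodes sit at neighbouring surfaces**: |j_{l+1} − j_l| = 1. [cite: Balaban1984PropagatorsII, (2.47) p.231] -/
theorem enc_walls_wadj (L : ℕ) : ∀ (rest : List (TW d k a)) (u : TW d k a) (st : Option ℕ), Inv u st →
    IsPath (graph L) u rest → ∀ l, l + 1 < (enc u rest st).runs.length →
    WAdj ((enc u rest st).runs.getD l (0, [])).1 ((enc u rest st).runs.getD (l + 1) (0, [])).1
  | [], u, st, _, _, l, hl => by simp [enc_nil] at hl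
  | v :: rest, u, st, hinv, ⟨huv, hch⟩, l, hl => by
      rcases adj_cases huv with ⟨hlv, -⟩ | hw
      · rw [enc_inbox_runs rest st hlv] at hl ⊢
        exact enc_walls_wadj L rest v st (inv_inbox hinv hlv) hch l hl
      · have hne' := lvl_ne_of_wall hw
        by_cases hs : st = some (max (lvl u) (lvl v))
        · rw [enc_same rest hne' hs] at hl ⊢
          exact enc_walls_wadj L rest v st (hs ▸ inv_wall huv hne') hch l hl
        · rw [enc_new_runs rest hne' hs] at hl ⊢
          rw [List.length_cons] at hl
          cases l with
          | zero =>
            rw [List.getD_cons_zero, List.getD_cons_succ]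
            have hne0 : (enc v rest (some (max (lvl u) (lvl v)))).runs ≠ [] :=
              List.ne_nil_of_length_pos (by omega)
            exact enc_head_wadj L rest v _ (inv_wall huv hne') hch hne0
          | succ l =>
            rw [List.getD_cons_succ, List.getD_cons_succ]
            exact enc_walls_wadj L rest v _ (inv_wall huv hne') hch l (by omega)

/-- **The first episode is at Σ_j or Σ_{j+1}** (j the level of the start). [cite: Balaban1984PropagatorsII, p.231
(*"intersects either the surface Σ_j, or the surface Σ_{j+1}, the first time at a point y₁"*)] -/
theorem enc_head_top (L : ℕ) : ∀ (rest : List (TW d k a)) (u : TW d k a), IsPath (graph L) u rest →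
    (enc u rest none).runs ≠ [] →
    ((enc u rest none).runs.getD 0 (0, [])).1 = lvl u ∨ ((enc u rest none).runs.getD 0 (0, [])).1 = lvl u + 1
  | [], u, _, hne => by simp [enc_nil] at hne
  | v :: rest, u, ⟨huv, hch⟩, hne => by
      rcases adj_cases huv with ⟨hl, -⟩ | hw
      · rw [enc_inbox_runs rest none hl] at hne ⊢
        rw [hl]
        exact enc_head_top L rest v hch hne
      · have hne' := lvl_ne_of_wall hw
        rw [enc_new_runs rest hne' (by simp), List.getD_cons_zero]
        rcases hw with ⟨h1, -⟩ | ⟨h1, -⟩ <;> omega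

/-- The wall of the last episode of a list of episodes read from a state. [folklore] -/
def lastW : Option ℕ → List (ℕ × List (Step d)) → Option ℕ
  | st, [] => st
  | _, r :: rs => lastW (some r.1) rs

omit [NeZero d] in
/-- lastW of a non-empty list is the wall of its last entry. [folklore] -/
theorem lastW_of_ne_nil : ∀ (rs : List (ℕ × List (Step d))) (st : Option ℕ), rs ≠ [] →
    lastW st rs = some (rs.getD (rs.length - 1) (0, [])).1
  | [], _, h => absurd rfl h
  | [r], st, _ => by simp [lastW]
  | r :: r' :: rs, st, _ => by
      rw [show lastW st (r :: r' :: rs) = lastW (some r.1) (r' :: rs) from rfl,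
        lastW_of_ne_nil (r' :: rs) (some r.1) (List.cons_ne_nil _ _)]
      simp only [List.length_cons, Nat.add_sub_cancel, List.getD_cons_succ]

/-- **The last episode is at a surface of the final box**: |j_m − j′| ≤ 1. [cite: Balaban1984PropagatorsII, (2.47) p.231
(*"Γ_{y′_m,y′} … contained in … B^{j′}(Λ_{j′})"*)] -/
theorem enc_lastW (L : ℕ) : ∀ (rest : List (TW d k a)) (u : TW d k a) (st : Option ℕ), Inv u st →
    IsPath (graph L) u rest → ∀ w, lastW st (enc u rest st).runs = some w →
    lvl (lastV u rest) = w ∨ lvl (lastV u rest) + 1 = w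
  | [], u, st, hinv, _, w, h => by
      rw [enc_nil] at h
      exact hinv w h
  | v :: rest, u, st, hinv, ⟨huv, hch⟩, w, h => by
      show lvl (lastV v rest) = w ∨ lvl (lastV v rest) + 1 = w
      rcases adj_cases huv with ⟨hl, -⟩ | hw
      · rw [enc_inbox_runs rest st hl] at h
        exact enc_lastW L rest v st (inv_inbox hinv hl) hch w h
      · have hne' := lvl_ne_of_wall hw
        by_cases hs : st = some (max (lvl u) (lvl v))
        · rw [enc_same rest hne' hs] at h
          exact enc_lastW L rest v st (hs ▸ inv_wall huv hne') hch w h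
        · rw [enc_new_runs rest hne' hs] at h
          exact enc_lastW L rest v _ (inv_wall huv hne') hch w h

/-- **No episode ⇒ the contour stays in one box**: j′ = j. [cite: Balaban1984PropagatorsII, (2.47) p.231] -/
theorem enc_top_noRuns (L : ℕ) : ∀ (rest : List (TW d k a)) (u : TW d k a), IsPath (graph L) u rest →
    (enc u rest none).runs = [] → lvl (lastV u rest) = lvl u
  | [], u, _, _ => rfl
  | v :: rest, u, ⟨huv, hch⟩, h => by
      show lvl (lastV v rest) = lvl u
      rcases adj_cases huv with ⟨hl, -⟩ | hw
      · rw [enc_inbox_runs rest none hl] at h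
        rw [hl]
        exact enc_top_noRuns L rest v hch h
      · rw [enc_new_runs rest (lvl_ne_of_wall hw) (by simp)] at h
        exact absurd h (List.cons_ne_nil _ _)

end Walls

/-! ## §7  The count data: (2.48) (legs are no longer than the contour) and (2.57) (episodes are RM apart) -/

section Counting

variable {d k a : ℕ} [NeZero d]

/-- **(2.48) on the tower**: the coded steps are bonds of the contour, each weighing 1.
[cite: Balaban1984PropagatorsII, (2.48) p.232] -/
theorem enc_length_le (L : ℕ) : ∀ (rest : List (TW d k a)) (u : TW d k a) (st : Option ℕ), IsPath (graph L) u rest →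
    (enc u rest st).pre.length + ((enc u rest st).runs.map (fun r => r.2.length)).sum ≤ rest.length
  | [], u, st, _ => by simp [enc_nil]
  | v :: rest, u, st, ⟨huv, hch⟩ => by
      rcases adj_cases huv with ⟨hl, -⟩ | hw
      · rw [enc_inbox rest st hl]
        have := enc_length_le L rest v st hch
        simp only [List.length_cons]
        omega
      · have hne' := lvl_ne_of_wall hw
        by_cases hs : st = some (max (lvl u) (lvl v))
        · rw [enc_same rest hne' hs]
          have := enc_length_le L rest v st hch
          simp only [List.length_cons]
          omega
        · rw [enc_new rest hne' hs]
          have := enc_length_le L rest v (some (max (lvl u) (lvl v))) hch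
          simp only [List.length_nil, List.map_cons, List.sum_cons, List.length_cons, zero_add]
          omega

omit [NeZero d] in
/-- Σ over `range length` of the indexed entries = Σ over the list. [folklore] -/
theorem sum_range_len_getD : ∀ (l : List (ℕ × List (Step d))),
    ∑ i ∈ Finset.range l.length, ((l.getD i (0, [])).2).length = (l.map (fun r => r.2.length)).sum
  | [] => by simp
  | x :: l => by
      rw [List.length_cons, Finset.sum_range_succ', List.getD_cons_zero, List.map_cons, List.sum_cons, add_comm]
      congr 1
      rw [← sum_range_len_getD l]
      refine Finset.sum_congr rfl fun i _ => ?_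
      rw [List.getD_cons_succ]

/-- The potential forcing ≥ a + 1 bonds between the starts of consecutive episodes: the number of e₀-steps still needed
to reach the other surface of the current box. [cite: Balaban1984PropagatorsII, (2.57) p.233 (*"from the condition (2.2)
and … that they belong to different surfaces Σ_j"*)] -/
def Φ (u : TW d k a) : Option ℕ → ℕ
  | none => 0
  | some w => if lvl u = w then a - (u.2 0 : ℕ) else (u.2 0 : ℕ)

/-- Φ with no episode open. [folklore] -/
theorem Φ_none (u : TW d k a) : Φ u none = 0 := rfl

/-- Φ in the upper box of the wall. [folklore] -/
theorem Φ_upper {u : TW d k a} {w : ℕ} (h : lvl u = w) : Φ u (some w) = a - (u.2 0 : ℕ) := by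
  simp [Φ, h]

/-- Φ in the lower box of the wall. [folklore] -/
theorem Φ_lower {u : TW d k a} {w : ℕ} (h : lvl u ≠ w) : Φ u (some w) = (u.2 0 : ℕ) := by
  simp [Φ, h]

/-- **(2.57) on the tower, as a bond count**: a contour with m ≥ 1 episodes has at least Φ + 1 + (m − 1)(a + 1) bonds —
consecutive episodes start at different surfaces of one box, a + 1 e₀-bonds apart. [cite: Balaban1984PropagatorsII,
(2.57) p.233] -/
theorem enc_runs_bound (L : ℕ) : ∀ (rest : List (TW d k a)) (u : TW d k a) (st : Option ℕ), Inv u st →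
    IsPath (graph L) u rest → (enc u rest st).runs ≠ [] →
    Φ u st + 1 + (enc u rest st).runs.length * (a + 1) ≤ rest.length + (a + 1)
  | [], u, st, _, _, hne => by simp [enc_nil] at hne
  | v :: rest, u, st, hinv, ⟨huv, hch⟩, hne => by
      rcases adj_cases huv with ⟨hl, hadj⟩ | hw
      · rw [enc_inbox_runs rest st hl] at hne ⊢
        have IH := enc_runs_bound L rest v st (inv_inbox hinv hl) hch hne
        have hΦ : Φ u st ≤ Φ v st + 1 := by
          cases st with
          | none => simp [Φ]
          | some w =>
            obtain ⟨h1, h2⟩ := idx0_step hadj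
            by_cases hw : lvl u = w
            · rw [Φ_upper hw, Φ_upper (hl ▸ hw)]; omega
            · rw [Φ_lower hw, Φ_lower (hl ▸ hw)]; omega
        rw [List.length_cons]
        omega
      · have hne' := lvl_ne_of_wall hw
        by_cases hs : st = some (max (lvl u) (lvl v))
        · subst hs
          rw [enc_same rest hne' rfl] at hne ⊢
          have IH := enc_runs_bound L rest v _ (inv_wall huv hne') hch hne
          have hΦ : Φ u (some (max (lvl u) (lvl v))) = Φ v (some (max (lvl u) (lvl v))) := by
            rcases hw with ⟨h1, h2, h3, -⟩ | ⟨h1, h2, h3, -⟩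
            · rw [Φ_lower (by omega), Φ_upper (by omega), h2, h3]; omega
            · rw [Φ_upper (by omega), Φ_lower (by omega), h2, h3]; omega
          rw [List.length_cons, hΦ]
          omega
        · rw [enc_new_runs rest hne' hs, List.length_cons, List.length_cons, Nat.succ_mul]
          have hΦu : Φ u st = 0 := by
            cases st with
            | none => rfl
            | some w =>
              have hw' : w ≠ max (lvl u) (lvl v) := fun h => hs (by rw [h])
              have hi := hinv w rfl
              rcases hw with ⟨h1, h2, h3, -⟩ | ⟨h1, h2, h3, -⟩
              · rw [Φ_upper (by omega), h2]; omega
              · rw [Φ_lower (by omega), h3]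
          have hΦv : Φ v (some (max (lvl u) (lvl v))) = a := by
            rcases hw with ⟨h1, h2, h3, -⟩ | ⟨h1, h2, h3, -⟩
            · rw [Φ_upper (by omega), h3]; omega
            · rw [Φ_lower (by omega), h2]
          by_cases hr : (enc v rest (some (max (lvl u) (lvl v)))).runs = []
          · rw [hr, List.length_nil, zero_mul]
            omega
          · have IH := enc_runs_bound L rest v _ (inv_wall huv hne') hch hr
            rw [hΦv] at IH
            omega

/-- **The first surface is decided by a face test on the decoded point y₁** (this is what makes j₁ ∈ {j, j+1}
recoverable: the pre-leg ends on the far face of B^j(Λ_j) iff the contour leaves through Σ_{j+1}; needs a ≥ 1, L ≥ 1).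
[cite: Balaban1984PropagatorsII, p.231] -/
theorem enc_head_face {L : ℕ} (hL : 1 ≤ L) (ha : 1 ≤ a) : ∀ (rest : List (TW d k a)) (u : TW d k a),
    IsPath (graph L) u rest → (enc u rest none).runs ≠ [] →
    ((enc u rest none).runs.getD 0 (0, [])).1 =
      if (pos L u + (L : ℤ) ^ lvl u • pathV (enc u rest none).pre) 0 = off L a (lvl u) + (a : ℤ) * (L : ℤ) ^ lvl u
      then lvl u + 1 else lvl u
  | [], u, _, hne => by simp [enc_nil] at hne
  | v :: rest, u, ⟨huv, hch⟩, hne => by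
      rcases adj_cases huv with ⟨hl, hadj⟩ | hw
      · rw [enc_inbox_runs rest none hl] at hne ⊢
        rw [enc_inbox_pre rest none hl]
        have hsv := svec_stepOf hadj (decide (none = some (lvl u + 1)))
        have hfun : pos L u + (L : ℤ) ^ lvl u • pathV (stepOf (zv u.2) (zv v.2) (decide (none = some (lvl u + 1))) ::
            (enc v rest none).pre) = pos L v + (L : ℤ) ^ lvl v • pathV (enc v rest none).pre := by
          funext i
          rw [pathV_cons, hsv]
          simp only [Pi.add_apply, Pi.smul_apply, Pi.sub_apply, smul_eq_mul]
          rw [pos_inbox L hl i, hl]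
          ring
        rw [hfun, hl]
        exact enc_head_face hL ha rest v hch hne
      · have hne' := lvl_ne_of_wall hw
        rw [enc_new_runs rest hne' (by simp), enc_new_pre rest hne' (by simp), List.getD_cons_zero, pathV_nil,
          smul_zero, add_zero]
        rcases hw with ⟨h1, h2, h3, -⟩ | ⟨h1, h2, h3, -⟩
        · rw [pos_zero_of_far h2, if_pos rfl]
          omega
        · have hpos : (0 : ℤ) < (a : ℤ) * (L : ℤ) ^ lvl u :=
            mul_pos (by exact_mod_cast ha) (pow_pos (by exact_mod_cast hL) _)
          rw [pos_zero_of_near h3, if_neg (by intro h; linarith)]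
          omega

omit [NeZero d] in
/-- Lists of equal length whose indexed entries have equal images have equal images. [folklore] -/
theorem map_eq_map_of_getD {α β : Type*} (f : α → β) (dflt : α) : ∀ (l₁ l₂ : List α), l₁.length = l₂.length →
    (∀ i, i < l₁.length → f (l₁.getD i dflt) = f (l₂.getD i dflt)) → l₁.map f = l₂.map f
  | [], [], _, _ => rfl
  | [], _ :: _, h, _ => absurd h (by simp)
  | _ :: _, [], h, _ => absurd h (by simp)
  | x :: l₁, x' :: l₂, h, hf => by
      have h0 := hf 0 (by simp)
      rw [List.getD_cons_zero, List.getD_cons_zero] at h0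
      have hlen : l₁.length = l₂.length := by simpa using h
      rw [List.map_cons, List.map_cons, h0, map_eq_map_of_getD f dflt l₁ l₂ hlen (fun i hi => by
        have := hf (i + 1) (by simpa using hi)
        rwa [List.getD_cons_succ, List.getD_cons_succ] at this)]

end Counting

/-! ## §8  Shortest contours and the decomposition data of the tower -/

section Tower

variable {d k a : ℕ} [NeZero d]

/-- A shortest admissible contour Γ_{y,y′} (the vertices after y). [cite: Balaban1984PropagatorsII, (2.46) p.231] -/
noncomputable def spath (L : ℕ) (y y' : TW d k a) : List (TW d k a) :=
  (exists_isPath_length_eq_dist (graph_connected L) y y').choose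

/-- Γ_{y,y′} is an admissible contour from y to y′ with d(y, y′) bonds. [cite: Balaban1984PropagatorsII, (2.46) p.231] -/
theorem spath_spec (L : ℕ) (y y' : TW d k a) :
    IsPath (graph L) y (spath L y y') ∧ lastV y (spath L y y') = y' ∧ (spath L y y').length = (graph L).dist y y' :=
  (exists_isPath_length_eq_dist (graph_connected L) y y').choose_spec

/-- hstep on the tower. [cite: Balaban1984PropagatorsII, (2.47) p.231] -/
theorem tower_hstep (L : ℕ) (y y' : TW d k a) (l : ℕ) (h : l + 1 < (enc y (spath L y y') none).runs.length) :
    |((((enc y (spath L y y') none).runs.getD (l + 1) (0, [])).1 : ℕ) : ℤ) -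
      ((((enc y (spath L y y') none).runs.getD l (0, [])).1 : ℕ) : ℤ)| ≤ 1 := by
  have hw := enc_walls_wadj L _ y none (inv_none y) (spath_spec L y y').1 l h
  unfold WAdj at hw
  rw [abs_le]
  constructor <;> omega

/-- hfirst on the tower. [cite: Balaban1984PropagatorsII, (2.47) p.231] -/
theorem tower_hfirst (L : ℕ) (y y' : TW d k a) (h : 0 < (enc y (spath L y y') none).runs.length) :
    |((((enc y (spath L y y') none).runs.getD 0 (0, [])).1 : ℕ) : ℤ) - ((lvl y : ℕ) : ℤ)| ≤ 1 := by
  have hw := enc_head_top L _ y (spath_spec L y y').1 (List.ne_nil_of_length_pos h)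
  rw [abs_le]
  constructor <;> omega

/-- hlast on the tower. [cite: Balaban1984PropagatorsII, (2.47) p.231] -/
theorem tower_hlast (L : ℕ) (y y' : TW d k a) (h : 0 < (enc y (spath L y y') none).runs.length) :
    |((((enc y (spath L y y') none).runs.getD ((enc y (spath L y y') none).runs.length - 1) (0, [])).1 : ℕ) : ℤ) -
      ((lvl y' : ℕ) : ℤ)| ≤ 1 := by
  obtain ⟨hp, hlast, -⟩ := spath_spec L y y'
  have hne : (enc y (spath L y y') none).runs ≠ [] := List.ne_nil_of_length_pos h
  have hw := enc_lastW L _ y none (inv_none y) hp _ (lastW_of_ne_nil _ none hne)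
  rw [hlast] at hw
  rw [abs_le]
  constructor <;> omega

/-- hzero on the tower. [cite: Balaban1984PropagatorsII, (2.47) p.231] -/
theorem tower_hzero (L : ℕ) (y y' : TW d k a) (h : (enc y (spath L y y') none).runs.length = 0) :
    |((lvl y : ℕ) : ℤ) - ((lvl y' : ℕ) : ℤ)| ≤ 1 := by
  obtain ⟨hp, hlast, -⟩ := spath_spec L y y'
  have hw := enc_top_noRuns L _ y hp (List.eq_nil_of_length_eq_zero h)
  rw [hlast] at hw
  rw [hw, sub_self, abs_zero]
  exact zero_le_one

/-- **hsep on the tower — (2.57)**: RM·(m − 1) ≤ d(y, y′) once RM ≤ a + 1 (the e₀-extent of a box in lattice units,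
print's (2.2)). [cite: Balaban1984PropagatorsII, (2.57) p.233] -/
theorem tower_hsep (L : ℕ) {M : ℕ} {R : ℝ} (hRM : R * (M : ℝ) ≤ (a : ℝ) + 1) (y y' : TW d k a) :
    R * (M : ℝ) * ((((enc y (spath L y y') none).runs.length - 1 : ℕ)) : ℝ) ≤ tdist L y y' := by
  obtain ⟨hp, -, hlen⟩ := spath_spec L y y'
  have hnat : ((enc y (spath L y y') none).runs.length - 1) * (a + 1) ≤ (spath L y y').length := by
    by_cases h0 : (enc y (spath L y y') none).runs = []
    · rw [h0, List.length_nil]; simp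
    · have hb := enc_runs_bound L _ y none (inv_none y) hp h0
      rw [Φ_none] at hb
      obtain ⟨r, hr⟩ : ∃ r, (enc y (spath L y y') none).runs.length = r + 1 :=
        ⟨(enc y (spath L y y') none).runs.length - 1, by have := List.length_pos_of_ne_nil h0; omega⟩
      rw [hr] at hb ⊢
      rw [Nat.succ_mul] at hb
      rw [Nat.add_sub_cancel]
      omega
  have hcast : ((((enc y (spath L y y') none).runs.length - 1 : ℕ)) : ℝ) * ((a : ℝ) + 1) ≤ tdist L y y' := by
    unfold tdist
    rw [← hlen]
    exact_mod_cast hnat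
  calc R * (M : ℝ) * ((((enc y (spath L y y') none).runs.length - 1 : ℕ)) : ℝ)
      ≤ ((a : ℝ) + 1) * ((((enc y (spath L y y') none).runs.length - 1 : ℕ)) : ℝ) :=
        mul_le_mul_of_nonneg_right hRM (Nat.cast_nonneg _)
    _ = ((((enc y (spath L y y') none).runs.length - 1 : ℕ)) : ℝ) * ((a : ℝ) + 1) := mul_comm _ _
    _ ≤ tdist L y y' := hcast

/-- **hwt on the tower — (2.48)**: the legs have at most d(y, y′) steps in all. [cite: Balaban1984PropagatorsII, (2.48) p.232] -/
theorem tower_hwt (L : ℕ) (y y' : TW d k a) :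
    ((((enc y (spath L y y') none).pre.length +
        ∑ l ∈ Finset.range (enc y (spath L y y') none).runs.length,
          (((enc y (spath L y y') none).runs.getD l (0, [])).2).length) +
        ∑ _l ∈ Finset.range (enc y (spath L y y') none).runs.length, ([] : List (Step d)).length : ℕ) : ℝ) ≤
      tdist L y y' := by
  obtain ⟨hp, -, hlen⟩ := spath_spec L y y'
  have h := enc_length_le L _ y none hp
  rw [← sum_range_len_getD] at h
  simp only [List.length_nil, Finset.sum_const_zero, add_zero]
  unfold tdist
  rw [← hlen]
  exact_mod_cast h

/-- **hinj on the tower — the reconstruction**: a site y′ of given level is determined by m, the codes of the legs and the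
branch signs of (j_l) (walls: the first by the face test, the rest by the signs; position: the decoder; site: positions
separate). [cite: Balaban1984PropagatorsII, (2.58) p.233] -/
theorem tower_hinj {L : ℕ} (hL : 1 ≤ L) (ha : 1 ≤ a) (y y₁ y₂ : TW d k a) (hl : lvl y₁ = lvl y₂)
    (hm : (enc y (spath L y y₁) none).runs.length = (enc y (spath L y y₂) none).runs.length)
    (hV : pathV (enc y (spath L y y₁) none).pre = pathV (enc y (spath L y y₂) none).pre)
    (hC : ∀ l, l < (enc y (spath L y y₁) none).runs.length →
      pathC ((enc y (spath L y y₁) none).runs.getD l (0, [])).2 = pathC ((enc y (spath L y y₂) none).runs.getD l (0, [])).2)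
    (hF : ∀ l, l < (enc y (spath L y y₁) none).runs.length →
      pathF ((enc y (spath L y y₁) none).runs.getD l (0, [])).2 = pathF ((enc y (spath L y y₂) none).runs.getD l (0, [])).2)
    (hsgn : ∀ l, l + 1 < (enc y (spath L y y₁) none).runs.length →
      (((((enc y (spath L y y₁) none).runs.getD (l + 1) (0, [])).1 : ℕ) : ℤ) -
          ((((enc y (spath L y y₁) none).runs.getD l (0, [])).1 : ℕ) : ℤ) ≤ 0 ↔
        ((((enc y (spath L y y₂) none).runs.getD (l + 1) (0, [])).1 : ℕ) : ℤ) -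
          ((((enc y (spath L y y₂) none).runs.getD l (0, [])).1 : ℕ) : ℤ) ≤ 0)) :
    y₁ = y₂ := by
  obtain ⟨hp₁, hlast₁, -⟩ := spath_spec L y y₁
  obtain ⟨hp₂, hlast₂, -⟩ := spath_spec L y y₂
  -- the walls agree
  have hw : ∀ l, l < (enc y (spath L y y₁) none).runs.length →
      ((enc y (spath L y y₁) none).runs.getD l (0, [])).1 = ((enc y (spath L y y₂) none).runs.getD l (0, [])).1 := by
    intro l
    induction l with
    | zero =>
      intro h0
      have e₁ := enc_head_face hL ha _ y hp₁ (List.ne_nil_of_length_pos h0)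
      have e₂ := enc_head_face hL ha _ y hp₂ (List.ne_nil_of_length_pos (hm ▸ h0))
      rw [e₁, e₂, hV]
    | succ l ih =>
      intro h
      have e := ih (by omega)
      have a₁ := enc_walls_wadj L _ y none (inv_none y) hp₁ l h
      have a₂ := enc_walls_wadj L _ y none (inv_none y) hp₂ l (hm ▸ h)
      have s := hsgn l h
      unfold WAdj at a₁ a₂
      omega
  -- the abstract episode data agree
  have hmap : (enc y (spath L y y₁) none).runs.map absRun = (enc y (spath L y y₂) none).runs.map absRun :=
    map_eq_map_of_getD absRun (0, []) _ _ hm (fun i hi => by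
      unfold absRun
      rw [hw i hi, hC i hi, hF i hi])
  -- decode both
  have d₁ := decS_enc L (spath L y y₁) y none (inv_none y) hp₁
  have d₂ := decS_enc L (spath L y y₂) y none (inv_none y) hp₂
  rw [hlast₁] at d₁
  rw [hlast₂] at d₂
  have hpos : pos L y₁ = pos L y₂ := by
    rw [← d₁, ← d₂]
    show decA L (pos L y + (L : ℤ) ^ lvl y • pathV (enc y (spath L y y₁) none).pre) (lvl y)
        ((enc y (spath L y y₁) none).runs.map absRun) (lvl y₁) =
      decA L (pos L y + (L : ℤ) ^ lvl y • pathV (enc y (spath L y y₂) none).pre) (lvl y)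
        ((enc y (spath L y y₂) none).runs.map absRun) (lvl y₂)
    rw [hV, hmap, hl]
  exact eq_of_pos_eq hL hl hpos

end Tower

/-! ## §9  H-B6.1 discharged on the tower; Lemma 2.1 with the L-free constant; non-vacuity -/

section Main

variable (d : ℕ) [NeZero d] (k a : ℕ)

/-- **THE DECOMPOSITION (2.47) WITH (2.48), (2.57) AND THE RECONSTRUCTION, CONSTRUCTED ON THE (k+1)-LEVEL TOWER** —
the census hypothesis H-B6.1 (`B6Lemma21Bridge.Decomp247`, binder `hdecomp` of `DagDischarged`) discharged for
`B6LevelTower.twGeo`, under L ≥ 1, a ≥ 1 and RM ≤ a + 1 (print's (2.2): big blocks fit in a box).  m = the number of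
surface episodes of a shortest contour, j_l their walls, leg0 = Γ_{y,y₁} coded at scale j, legS l = Γ_{y_l,y′_l} ∪
Γ_{y′_l,y_{l+1}} coded at the two scales of Σ_{j_l} (legX empty: the crossing legs ride with the surface legs, which only
lowers the count (2.58″)). [cite: Balaban1984PropagatorsII, (2.46)–(2.48) pp.231–232, (2.57)–(2.58) p.233] -/
noncomputable def decomp247 (L M : ℕ) (η R : ℝ) (hL : 1 ≤ L) (ha : 1 ≤ a) (hRM : R * (M : ℝ) ≤ (a : ℝ) + 1)
    (y : TW d k a) : Decomp247 (twGeo d k a M L η R) d y where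
  m := fun y' => (enc y (spath L y y') none).runs.length
  js := fun y' l => ((((enc y (spath L y y') none).runs.getD l (0, [])).1 : ℕ) : ℤ)
  leg0 := fun y' => (enc y (spath L y y') none).pre
  legS := fun y' l => ((enc y (spath L y y') none).runs.getD l (0, [])).2
  legX := fun _ _ => []
  hstep := fun y' l h => tower_hstep L y y' l h
  hfirst := fun y' h => tower_hfirst L y y' h
  hlast := fun y' h => tower_hlast L y y' h
  hzero := fun y' h => tower_hzero L y y' h
  hsep := fun y' => tower_hsep L hRM y y'
  hwt := fun y' => tower_hwt L y y'
  hinj := fun y₁ y₂ hl hm hV hC hF _ hs => tower_hinj hL ha y y₁ y₂ hl hm hV hC hF hs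

/-- **LEMMA 2.1 (2.61″) ON EVERY TOWER WITH THE L-FREE TWO-SCALE CONSTANT** c₁″ = 13c₀(½α)^{4d}, under (2.59):
sup_y Σ_{y′∈𝔅} e^{−αδ₀d(y,y′)} ≤ c₁″ — by the kernel bridge `B6Lemma21Bridge.ineq261T_of_decomp` applied to the
constructed decomposition.  (The constant does not depend on L, k, a, M, R; compare the direct single-scale count
`B6TowerSums.twGeo_ineq261With`, whose constant carries L^{d−1}.) [cite: Balaban1984PropagatorsII, Lemma 2.1 (2.61)
p.234 with (2.58)–(2.59) p.233; corrected constant] -/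
theorem twGeo_ineq261T (L M : ℕ) (η R : ℝ) (hL : 1 ≤ L) (ha : 1 ≤ a) (hRM : R * (M : ℝ) ≤ (a : ℝ) + 1)
    {δ₀ α : ℝ} (hα : 0 < α) (hδ : 0 < δ₀) (h259 : B6.Cond259 d δ₀ α R M) :
    B6Lemma21Repaired.Ineq261With (B6Lemma21TwoScale.c1TwoScale d δ₀ α) (twGeo d k a M L η R) δ₀ α :=
  B6Lemma21Bridge.ineq261T_of_decomp hα hδ h259 (decomp247 d k a L M η R hL ha hRM)

/-- The same, unpacked: Σ_{y′} e^{−αδ₀ d(y,y′)} ≤ 13c₀(½α)^{4d} for every site y of the tower.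
[cite: Balaban1984PropagatorsII, (2.61) p.234; corrected constant] -/
theorem tower_sum_exp_le (L M : ℕ) (η R : ℝ) (hL : 1 ≤ L) (ha : 1 ≤ a) (hRM : R * (M : ℝ) ≤ (a : ℝ) + 1)
    {δ₀ α : ℝ} (hα : 0 < α) (hδ : 0 < δ₀) (h259 : B6.Cond259 d δ₀ α R M) (y : TW d k a) :
    ∑ y' : TW d k a, Real.exp (-(α * δ₀ * tdist L y y')) ≤ 13 * B6.c0 δ₀ (α / 2) ^ (4 * d) :=
  twGeo_ineq261T d k a L M η R hL ha hRM hα hδ h259 y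

/-- **`B6Lemma21TwoScale.Lemma21TwoScale` ON EVERY FAMILY OF TOWERS** ((2.60) and (2.61″) for all 0 < α < 1 under
(2.59)), by `B6Lemma21Bridge.lemma21TwoScale_of_decomp`: realisation, connectedness and the level gap a + 1 are the
tower's (`B6LevelTower`), the decomposition is `decomp247`. [cite: Balaban1984PropagatorsII, Lemma 2.1 p.234; corrected] -/
theorem lemma21TwoScale_towers {I : Type} (kk aa MM LL : I → ℕ) (ηη RR : I → ℝ) (hL : ∀ i, 1 ≤ LL i)
    (ha : ∀ i, 1 ≤ aa i) (hRM : ∀ i, RR i * (MM i : ℝ) ≤ (aa i : ℝ) + 1) (δ₀ : ℝ) (hδ : 0 < δ₀) :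
    B6Lemma21TwoScale.Lemma21TwoScale d δ₀ (fun i => twGeo d (kk i) (aa i) (MM i) (LL i) (ηη i) (RR i)) :=
  B6Lemma21Bridge.lemma21TwoScale_of_decomp d δ₀ hδ _
    (fun i => twCS d (kk i) (aa i) (MM i) (LL i) (ηη i) (RR i)) (fun i => aa i + 1)
    (fun i => twGeo_realizes d (kk i) (aa i) (MM i) (LL i) (ηη i) (RR i))
    (fun i => twCS_connected d (kk i) (aa i) (MM i) (LL i) (ηη i) (RR i))
    (fun i => twCS_levelGap d (kk i) (aa i) (MM i) (LL i) (ηη i) (RR i) (hL i))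
    (fun i => by push_cast; exact hRM i)
    (fun i _ y => decomp247 d (kk i) (aa i) (LL i) (MM i) (ηη i) (RR i) (hL i) (ha i) (hRM i) y)

omit [NeZero d] in
/-- (2.59) is satisfiable together with RM ≤ a + 1: for every d, δ₀ > 0, α > 0 there are a ≥ 1 and R = a + 1, M = 1
with ¼αδ₀RM > 2d log c₀(½α) + 1 (Archimedes; no bound on c₀ needed). [folklore] -/
theorem cond259_witness {δ₀ α : ℝ} (hδ : 0 < δ₀) (hα : 0 < α) :
    ∃ a : ℕ, 1 ≤ a ∧ B6.Cond259 d δ₀ α ((a : ℝ) + 1) ((1 : ℕ) : ℝ) := by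
  set A : ℝ := 2 * d * Real.log (B6.c0 δ₀ (α / 2)) + 1 with hA
  have hp : 0 < α * δ₀ := mul_pos hα hδ
  refine ⟨⌈4 * A / (α * δ₀)⌉₊ + 1, by omega, ?_⟩
  unfold B6.Cond259
  rw [← hA]
  have hq : 4 * A / (α * δ₀) ≤ (⌈4 * A / (α * δ₀)⌉₊ : ℝ) := Nat.le_ceil _
  have h1 : (1 / 4) * α * δ₀ * (4 * A / (α * δ₀)) = A := by
    field_simp
  have h2 : (1 / 4) * α * δ₀ * (4 * A / (α * δ₀)) ≤ (1 / 4) * α * δ₀ * (⌈4 * A / (α * δ₀)⌉₊ : ℝ) :=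
    mul_le_mul_of_nonneg_left hq (by positivity)
  push_cast
  nlinarith

/-- **NON-VACUITY of the tower Lemma 2.1**: for every d, k, L ≥ 1, η, δ₀ > 0, α > 0 there is a tower (a ≥ 1, M = 1,
R = a + 1) meeting RM ≤ a + 1 and (2.59), on which therefore (2.61″) holds with c₁″. [folklore] -/
theorem towerDecomp_nonvacuous (L : ℕ) (η : ℝ) (hL : 1 ≤ L) {δ₀ α : ℝ} (hδ : 0 < δ₀) (hα : 0 < α) :
    ∃ (a : ℕ) (R : ℝ), 1 ≤ a ∧ R * ((1 : ℕ) : ℝ) ≤ (a : ℝ) + 1 ∧ B6.Cond259 d δ₀ α R ((1 : ℕ) : ℝ) ∧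
      B6Lemma21Repaired.Ineq261With (B6Lemma21TwoScale.c1TwoScale d δ₀ α) (twGeo d k a 1 L η R) δ₀ α := by
  obtain ⟨a, ha, h259⟩ := cond259_witness d hδ hα
  refine ⟨a, (a : ℝ) + 1, ha, by push_cast; linarith, h259, ?_⟩
  exact twGeo_ineq261T d k a L 1 η ((a : ℝ) + 1) hL ha (by push_cast; linarith) hα hδ h259

end Main

end Literature.MathematicalPhysics.QuantumFieldTheory.Balaban1983to89.B6TowerDecomp
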